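import Literature.AlgebraicGeometry.PlaneCurves.HessePencilTranslationIncidences
import Literature.AlgebraicGeometry.PlaneCurves.WeierstrassLineIntersectionCycle
import Literature.AlgebraicGeometry.PlaneCurves.HessePencilWeierstrassForm
import Literature.AlgebraicGeometry.PlaneCurves.HessianCovariance
import HarnessLib

/-!
# The group law on the Hesse pencil: `g₂` and `g₁⁻¹` are the translations by `p₁` and `p₃`, `g₀` is `−1` (Artebani–Dolgachev §2, §4)

Topic `Literature/AlgebraicGeometry/PlaneCurves`, namespace `Literature.AlgebraicGeometry.PlaneCurves`.
Lane `lit-hodgefound`, seat `lit-hodgefound-p37`, row g20-#3; the sequel announced in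
`HessePencilTranslationIncidences` (g20-#2: the collinearities `det[p; p₁; σ₁p] = 0`,
`det[p₀; σ₁p; g₂p] = 0`, … and the tangencies of the coincident cases) and
`WeierstrassLineIntersectionCycle` (g20-#1: Kunz Cor. 10.7 with multiplicities for Mathlib's group
law), using the Weierstrass model of `HessePencilWeierstrassForm` (Q1834: `H_μ ∘ M_μ = (μ³ − 1)·W_μ`)
and the transport lemmas of `HessianCovariance` (Q1666).  Everything here is PROVED; no
definition, no named fact.

Source followed — M. Artebani, I. Dolgachev, *The Hesse pencil of plane cubic curves*,
L'Enseignement Math. (2) 55 (2009) 235–273 [arXiv:math/0611590, held `paper:arxiv-math_0611590`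
p0004 L5–L6, L25–L40, p0008 L17–L19], VERBATIM:

> (§2) Fixing one of the inflection points `p₀` defines a commutative group law `⊕` on `E` with
> `p₀` equal to the zero: `p ⊕ q` is the unique point `r` such that `p₀, r` and the third point of
> intersection in `p̄q̄ ∩ E` lie on a line. […] If we fix the group law by choosing the point `p₀`
> to be the zero point, then the set of inflection points is the group of 3-torsion points of each
> member of the Hesse pencil. Hence we can define an isomorphism `α : E_λ[3]_{p₀} → (ℤ/3ℤ)²` by
> sending the point `p₁ = (0, 1, −ε)` to `(1, 0)` and the point `p₃ = (1, 0, −1)` to `(0, 1)`.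
> Under this isomorphism we can identify the nine base points with elements of `(ℤ/3ℤ)²` as
> follows: `p₀ p₁ p₂ / p₃ p₄ p₅ / p₆ p₇ p₈ = (0,0) (1,0) (2,0) / (0,1) (1,1) (2,1) / (0,2) (1,2) (2,2)`.
> (§4) If we use the group law with zero `p₀` on a nonsingular member of the pencil, then `g₁`
> induces the translation by the 3-torsion point `p₃` and `g₂` that by the point `p₁`.

## The dictionary: which group

The member `H_μ = X³ + Y³ + Z³ − 3μXYZ` (`μ³ ≠ 1`, `3 ≠ 0`: smooth) has the elliptic Weierstrass
model `W_μ = ⟨−μ, −μ², (μ³−1)/3, μ(μ³−1)/3, −(μ³−1)²/27⟩` with `H_μ ∘ M_μ = (μ³ − 1)·W_μ` (Q1834);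
composing with `t₃ = g₁²` (which fixes `H_μ`) gives `N_μ = t₃ M_μ = [[1, 0, 0], [−μ, 1, (μ³−1)/3],
[0, −1, 0]]` with `H_μ ∘ N_μ = (μ³ − 1)·W_μ` AND `N_μ (0, 1, 0) = (0, 1, −1) = p₀`: the projectivity
`v ↦ N_μ v` carries `{W_μ = 0}` onto `{H_μ = 0}` and Mathlib's zero `O` to A–D's zero `p₀`.  Since a
projectivity carries lines to lines and tangents to tangents, it carries the printed chord–tangent
recipe with zero `p₀` to Mathlib's group law on `W_μ(K)` (whose zero `O` is a flex and in which
three points of a line add up to `O`, Kunz Cor. 10.7 — g20-#1).  So "the group law with zero `p₀`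
on `H_μ`" is, in this file, Mathlib's `W_μ.toAffine.Point` read through `P ↦ N_μ · vec P`
(`vec O = (0, 1, 0)`, `vec (x, y) = (x, y, 1)`, two hypotheses on a variable `vec`, no definition):
every point of `H_μ(K)` is `c · N_μ vec P` for exactly one `P` (`exists_point_of_hesse`,
`point_eq_of_hessePoint_smul`).

## What is here (`K` a field with `3 ≠ 0`, `μ³ ≠ 1`, `ω² + ω + 1 = 0`)

* §1 the model: `N_μ = t₃ M_μ`, `H_μ ∘ N_μ = (μ³ − 1)·W_μ`, `N_μ O = p₀`, `det N_μ ≠ 0`; evaluation,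
  gradient and collinearity transport (`hesse_eval_N_mulVec`, `hesse_grad_N_dotProduct`, …); points
  of `H_μ` ↔ points of `W_μ`.
* §2 **`g₀` is `−1`**: `hesse_neg_iff` — `N vec Q ∥ g₀ (N vec P)` iff `Q = −P`.
* §3 the translation principle (`hesse_translation_principle`): a projectivity `g` preserving
  `H_μ`, together with an involution `σ` preserving `H_μ` such that `p, t, σp` and `p₀, σp, gp` are
  collinear (g20-#2), is the translation `Q = P + T` by the point `T` over `t` — Kunz Cor. 10.7 with
  multiplicities (g20-#1) applied twice; `three_nsmul_eq_zero_of_inflectionTangent`.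
* §4 **"`g₂` [induces the translation] by the point `p₁`"** and **"`g₁` induces the translation by
  the 3-torsion point `p₃`"**: with `T₁, T₃` the points over `p₁ = (0, 1, −ω)`, `p₃ = (1, 0, −1)`
  (`exists_point_p₁_p₃`; `three_nsmul_T₁`, `three_nsmul_T₃`): `hesse_translation_g₂_iff` —
  `N vec Q ∥ g₂ (N vec P)` iff `Q = P + T₁`; `hesse_translation_t₃_iff` — for the point map
  `t₃ = g₁⁻¹`, `N vec Q ∥ t₃ (N vec P)` iff `Q = P + T₃`; `hesse_translation_g₁_iff` — `Q = P − T₃`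
  (so the printed `g₁`, as a point map, is the translation by `−p₃ = p₆`; as a substitution in
  equations it is `t₃`, the translation by `p₃`).
* §5 **A–D's table (matrix2)**: `hesse_basePoints_eq_torsion` — the point over `p_{a+3b}` is
  `a·T₁ + b·T₃` for all nine `(a, b)`; in particular the nine base points are `3`-torsion points
  ("the set of inflection points is the group of 3-torsion points", the inclusion that does not
  need `K = K̄`).

NOT here: that `T₁, T₃` generate ALL of `W_μ(K)[3]` (needs `#E[3] ≤ 9`, i.e. `K = K̄` in the
tree's `card_torsionBy_three`), the points of order `9` (Prop. 5.2 — the next row), `S(3)`.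

## References
* [ArtebaniDolgachev2009] M. Artebani, I. Dolgachev, *The Hesse pencil of plane cubic curves*,
  Enseign. Math. (2) 55 (2009) 235–273, §2 (the group law with zero `p₀`, the table (matrix2)),
  §4 ("`g₁` induces the translation by `p₃` and `g₂` that by `p₁`").
* [Kunz2005PlaneAlgebraicCurves] E. Kunz, *Introduction to Plane Algebraic Curves*, Birkhäuser
  2005, Ch. 10, Cor. 10.7.
* [Knapp1992] A. W. Knapp, *Elliptic Curves*, Princeton 1992, §II.4, Prop. 2.14 (projective
  transformations of cubics).
-/

set_option autoImplicit false

open MvPolynomial Matrix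

namespace Literature.AlgebraicGeometry.PlaneCurves

universe u

/-- The Hesse cubic `H_μ = X³ + Y³ + Z³ − 3μXYZ` (local notation, no definition). -/
local notation3 "𝐇[" μ "]" =>
  (X 0 ^ 3 + X 1 ^ 3 + X 2 ^ 3 - C (3 * μ) * (X 0 * X 1 * X 2) : MvPolynomial (Fin 3) _)

/-- The Weierstrass model `W_μ` of `H_μ` (`HessePencilWeierstrassForm`; local notation). -/
local notation3 "𝐖[" μ "]" =>
  ({ a₁ := -μ, a₂ := -μ ^ 2, a₃ := (μ ^ 3 - 1) / 3, a₄ := μ * (μ ^ 3 - 1) / 3,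
     a₆ := -(μ ^ 3 - 1) ^ 2 / 27 } : WeierstrassCurve _)

/-- The substitution `M_μ` with `H_μ ∘ M_μ = (μ³ − 1) · W_μ` (Q1834; local notation). -/
local notation3 "𝐌[" μ "]" =>
  (Matrix.of ![![-μ, 1, (μ ^ 3 - 1) / 3], ![0, -1, 0], ![1, 0, 0]] : Matrix (Fin 3) (Fin 3) _)

/-- `N_μ = t₃ M_μ = [[1, 0, 0], [−μ, 1, (μ³−1)/3], [0, −1, 0]]`: `H_μ ∘ N_μ = (μ³ − 1)·W_μ` and
`N_μ(0, 1, 0) = p₀` (local notation, no definition). -/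
local notation3 "𝐍[" μ "]" =>
  (Matrix.of ![![1, 0, 0], ![-μ, 1, (μ ^ 3 - 1) / 3], ![0, -1, 0]] : Matrix (Fin 3) (Fin 3) _)

/-- `g₀ = (x, z, y)`, `g₁ = (y, z, x)`, `t₃ = g₁⁻¹ = (z, x, y)`, `g₂ = diag(1, ε, ε²)`, and the
companions `σ₁ = (x, ω²z, ωy)`, `σ₃ = (z, y, x)` (local notations as in
`HessePencilTranslationIncidences`, no definitions). -/
local notation3 "𝐠₀" => (Matrix.of ![![(1 : _), 0, 0], ![0, 0, 1], ![0, 1, 0]] : Matrix (Fin 3) (Fin 3) _)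
local notation3 "𝐠₁" => (Matrix.of ![![(0 : _), 1, 0], ![0, 0, 1], ![1, 0, 0]] : Matrix (Fin 3) (Fin 3) _)
local notation3 "𝐭₃" => (Matrix.of ![![(0 : _), 0, 1], ![1, 0, 0], ![0, 1, 0]] : Matrix (Fin 3) (Fin 3) _)
local notation3 "𝐠₂[" ω "]" =>
  (Matrix.of ![![(1 : _), 0, 0], ![0, ω, 0], ![0, 0, ω ^ 2]] : Matrix (Fin 3) (Fin 3) _)
local notation3 "𝛔₁[" ω "]" =>
  (Matrix.of ![![(1 : _), 0, 0], ![0, 0, ω ^ 2], ![0, ω, 0]] : Matrix (Fin 3) (Fin 3) _)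
local notation3 "𝛔₃" => (Matrix.of ![![(0 : _), 0, 1], ![0, 1, 0], ![1, 0, 0]] : Matrix (Fin 3) (Fin 3) _)

section GroupLaw

variable {K : Type u} [Field K]

/-! ## §1 The model `N_μ`: `H_μ ∘ N_μ = (μ³ − 1)·W_μ`, `N_μ O = p₀` -/

/-- `N_μ = t₃ · M_μ`. [cite: ArtebaniDolgachev2009, §2 (Lemma 1: the Hesse and Weierstrass canonical
forms)] -/
theorem hesseN_eq_t₃_mul (μ : K) : (𝐍[μ] : Matrix (Fin 3) (Fin 3) K) = 𝐭₃ * 𝐌[μ] := by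
  ext i j : 1
  fin_cases i <;> fin_cases j <;> simp [Matrix.mul_apply, Fin.sum_univ_three]

/-- `N_μ` carries Mathlib's zero `O = (0, 1, 0)` to A–D's zero `p₀ = (0, 1, −1)`, and an affine
vector `(x, y, 1)` to `(x, −μx + y + (μ³ − 1)/3, −y)`. [cite: ArtebaniDolgachev2009, §2 ("Fixing one
of the inflection points `p₀` defines a commutative group law")] -/
theorem hesseN_mulVec (μ : K) (v : Fin 3 → K) :
    (𝐍[μ] : Matrix (Fin 3) (Fin 3) K) *ᵥ v = ![v 0, -μ * v 0 + v 1 + (μ ^ 3 - 1) / 3 * v 2, -v 1] ∧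
      (𝐍[μ] : Matrix (Fin 3) (Fin 3) K) *ᵥ ![0, 1, 0] = ![0, 1, -1] := by
  constructor <;>
  · funext i; fin_cases i <;> simp [Matrix.mulVec, dotProduct, Fin.sum_univ_three]

/-- `det N_μ = (μ³ − 1)/3`. [cite: ArtebaniDolgachev2009, §2 (the singular members are `μ³ = 1`)] -/
theorem hesseN_det (μ : K) : (𝐍[μ] : Matrix (Fin 3) (Fin 3) K).det = (μ ^ 3 - 1) / 3 := by
  rw [Matrix.det_fin_three]; simp

/-- `det N_μ ≠ 0` for a smooth member (`3 ≠ 0`, `μ³ ≠ 1`): `N_μ` is a projectivity.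
[cite: ArtebaniDolgachev2009, §2 (the singular members are `μ³ = 1`)] -/
theorem hesseN_det_ne_zero (h3 : (3 : K) ≠ 0) {μ : K} (hμ : μ ^ 3 ≠ 1) :
    (𝐍[μ] : Matrix (Fin 3) (Fin 3) K).det ≠ 0 := by
  rw [hesseN_det]; exact div_ne_zero (sub_ne_zero.2 hμ) h3

/-- **`H_μ ∘ N_μ = (μ³ − 1) · W_μ`** (`3 ≠ 0`): `t₃ = g₁²` fixes `H_μ`
(`HessePencilHessianGroup.hesse_bind₁_g₁`) and `H_μ ∘ M_μ = (μ³ − 1)·W_μ` (Q1834).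
[cite: ArtebaniDolgachev2009, §2 (Lemma 1 and the Weierstrass form (weir))] -/
theorem hesse_bind₁_N (h3 : (3 : K) ≠ 0) (μ : K) :
    bind₁ (𝐍[μ] : Matrix (Fin 3) (Fin 3) K).toMvPolynomial 𝐇[μ] =
      (μ ^ 3 - 1) • (𝐖[μ] : WeierstrassCurve K).toProjective.polynomial := by
  have ht : (𝐭₃ : Matrix (Fin 3) (Fin 3) K) = 𝐠₁ * 𝐠₁ := (t₃_eq_g₁_sq_and_σ_sq (one_pow 3)).1
  rw [hesseN_eq_t₃_mul, bind₁_toMvPolynomial_mul, ht, bind₁_toMvPolynomial_mul, hesse_bind₁_g₁,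
    hesse_bind₁_g₁, hesse_bind₁_eq_smul_weierstrass h3 μ]

/-- Evaluation transport: `H_μ(N_μ v) = (μ³ − 1) · W_μ(v)`. [cite: Knapp1992, §II.4, Prop. 2.14] -/
theorem hesse_eval_N_mulVec (h3 : (3 : K) ≠ 0) (μ : K) (v : Fin 3 → K) :
    eval ((𝐍[μ] : Matrix (Fin 3) (Fin 3) K) *ᵥ v) 𝐇[μ] =
      (μ ^ 3 - 1) * eval v (𝐖[μ] : WeierstrassCurve K).toProjective.polynomial := by
  rw [← eval_bind₁_toMvPolynomial, hesse_bind₁_N h3, smul_eval]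

/-- Tangent transport: `⟨∇H_μ(N_μ v), N_μ w⟩ = (μ³ − 1) · ⟨∇W_μ(v), w⟩`
(`HessianCovariance.grad_bind₁_toMvPolynomial_dotProduct`). [cite: Knapp1992, §II.4, Prop. 2.14] -/
theorem hesse_grad_N_dotProduct (h3 : (3 : K) ≠ 0) (μ : K) (v w : Fin 3 → K) :
    (fun i => eval ((𝐍[μ] : Matrix (Fin 3) (Fin 3) K) *ᵥ v) (pderiv i 𝐇[μ])) ⬝ᵥ
        ((𝐍[μ] : Matrix (Fin 3) (Fin 3) K) *ᵥ w) =
      (μ ^ 3 - 1) * ((fun j => eval v (pderiv j (𝐖[μ] : WeierstrassCurve K).toProjective.polynomial)) ⬝ᵥ w) := by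
  rw [← grad_bind₁_toMvPolynomial_dotProduct, hesse_bind₁_N h3]
  simp only [dotProduct, smul_eq_C_mul, pderiv_C_mul, map_mul, eval_C, Finset.mul_sum]
  exact Finset.sum_congr rfl fun j _ => by ring

/-- Collinearity transport: `det[N a; N b; N c] = det N · det[a; b; c]`. [cite: Knapp1992, §II.4,
Prop. 2.14] -/
theorem det_rows_hesseN_mulVec (μ : K) (a b c : Fin 3 → K) :
    (Matrix.of ![(𝐍[μ] : Matrix (Fin 3) (Fin 3) K) *ᵥ a, (𝐍[μ] : Matrix (Fin 3) (Fin 3) K) *ᵥ b,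
      (𝐍[μ] : Matrix (Fin 3) (Fin 3) K) *ᵥ c]).det =
      (𝐍[μ] : Matrix (Fin 3) (Fin 3) K).det * (Matrix.of ![a, b, c]).det := by
  rw [Matrix.det_fin_three, Matrix.det_fin_three, Matrix.det_fin_three]
  simp [dotProduct, Fin.sum_univ_three]
  ring

/-- Scalars in a row: `det[a; c·b; d] = c·det[a; b; d]`, `det[a; b; c·d] = c·det[a; b; d]`,
`det[c·a; b; d] = c·det[a; b; d]`. [folklore] -/
private theorem det_rows_smul (c : K) (a b d : Fin 3 → K) :
    (Matrix.of ![a, c • b, d]).det = c * (Matrix.of ![a, b, d]).det ∧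
      (Matrix.of ![a, b, c • d]).det = c * (Matrix.of ![a, b, d]).det ∧
      (Matrix.of ![c • a, b, d]).det = c * (Matrix.of ![a, b, d]).det := by
  refine ⟨?_, ?_, ?_⟩ <;>
  · rw [Matrix.det_fin_three, Matrix.det_fin_three]
    simp
    ring

/-- Scaling a point of `ℙ²`: `H_μ(c·p) = c³ H_μ(p)` and `⟨∇H_μ(c·p), q⟩ = c² ⟨∇H_μ(p), q⟩`.
[folklore] -/
private theorem hesse_eval_grad_smul (μ c : K) (p q : Fin 3 → K) :
    eval (c • p) 𝐇[μ] = c ^ 3 * eval p 𝐇[μ] ∧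
      (fun i => eval (c • p) (pderiv i 𝐇[μ])) ⬝ᵥ q = c ^ 2 * ((fun i => eval p (pderiv i 𝐇[μ])) ⬝ᵥ q) := by
  rw [hesse_eval, hesse_eval, hesse_eval_pderiv, hesse_eval_pderiv]
  simp [dotProduct, Fin.sum_univ_three]
  constructor <;> ring

variable {μ : K} (vec : (𝐖[μ] : WeierstrassCurve K).toAffine.Point → Fin 3 → K)

/-- **Every point of `W_μ(K)` gives a point of `H_μ(K)`**: `N_μ vec P ≠ 0` and `H_μ(N_μ vec P) = 0`.
[cite: ArtebaniDolgachev2009, §2 (Lemma 1)] -/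
theorem hessePoint_ne_zero_and_eval (h3 : (3 : K) ≠ 0) (hμ : μ ^ 3 ≠ 1)
    (hv0 : vec 0 = ![0, 1, 0])
    (hvs : ∀ x y (h : (𝐖[μ] : WeierstrassCurve K).toAffine.Nonsingular x y), vec (.some x y h) = ![x, y, 1])
    (P : (𝐖[μ] : WeierstrassCurve K).toAffine.Point) :
    (𝐍[μ] : Matrix (Fin 3) (Fin 3) K) *ᵥ vec P ≠ 0 ∧
      eval ((𝐍[μ] : Matrix (Fin 3) (Fin 3) K) *ᵥ vec P) 𝐇[μ] = 0 := by
  have hdet := hesseN_det_ne_zero h3 hμ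
  constructor
  · intro h
    have h' : vec P = 0 := by
      have := congrArg (fun w => (𝐍[μ] : Matrix (Fin 3) (Fin 3) K)⁻¹ *ᵥ w) h
      simp only [Matrix.mulVec_mulVec, Matrix.nonsing_inv_mul _ (isUnit_iff_ne_zero.2 hdet),
        Matrix.one_mulVec, Matrix.mulVec_zero] at this
      exact this
    rcases P with _ | ⟨x, y, h⟩
    · rw [← WeierstrassCurve.Affine.Point.zero_def, hv0] at h'
      simpa using congrFun h' 1
    · rw [hvs] at h'
      simpa using congrFun h' 2
  · rw [hesse_eval_N_mulVec h3]
    rcases P with _ | ⟨x, y, h⟩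
    · rw [← WeierstrassCurve.Affine.Point.zero_def, hv0]
      have : eval ![(0 : K), 1, 0] (𝐖[μ] : WeierstrassCurve K).toProjective.polynomial = 0 :=
        WeierstrassCurve.Projective.equation_zero
      rw [this, mul_zero]
    · rw [hvs]
      have : eval ![x, y, 1] (𝐖[μ] : WeierstrassCurve K).toProjective.polynomial = 0 :=
        (WeierstrassCurve.Projective.equation_some x y).2 h.1
      rw [this, mul_zero]

/-- **Every point of `H_μ(K)` comes from exactly one point of `W_μ(K)`, existence**: a vector `p ≠ 0`
with `H_μ(p) = 0` is `c · N_μ vec P` (`c ≠ 0`). [cite: ArtebaniDolgachev2009, §2 (Lemma 1)]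
[cite: Knapp1992, §II.4, Prop. 2.14] -/
theorem exists_point_of_hesse (h3 : (3 : K) ≠ 0) (hμ : μ ^ 3 ≠ 1) (hv0 : vec 0 = ![0, 1, 0])
    (hvs : ∀ x y (h : (𝐖[μ] : WeierstrassCurve K).toAffine.Nonsingular x y), vec (.some x y h) = ![x, y, 1])
    {p : Fin 3 → K} (hp : p ≠ 0) (hH : eval p 𝐇[μ] = 0) :
    ∃ (P : (𝐖[μ] : WeierstrassCurve K).toAffine.Point) (c : K),
      c ≠ 0 ∧ p = c • ((𝐍[μ] : Matrix (Fin 3) (Fin 3) K) *ᵥ vec P) := by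
  haveI hE : (𝐖[μ] : WeierstrassCurve K).IsElliptic := (hesse_weierstrass_isElliptic_iff h3 μ).2 hμ
  have hdet := hesseN_det_ne_zero h3 hμ
  set v : Fin 3 → K := (𝐍[μ] : Matrix (Fin 3) (Fin 3) K)⁻¹ *ᵥ p with hv
  have hNv : (𝐍[μ] : Matrix (Fin 3) (Fin 3) K) *ᵥ v = p := by
    rw [hv, Matrix.mulVec_mulVec, Matrix.mul_nonsing_inv _ (isUnit_iff_ne_zero.2 hdet),
      Matrix.one_mulVec]
  have hvne : v ≠ 0 := fun h => hp (by rw [← hNv, h, Matrix.mulVec_zero])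
  have hWv : (𝐖[μ] : WeierstrassCurve K).toProjective.Equation v := by
    have h := hesse_eval_N_mulVec h3 μ v
    rw [hNv, hH] at h
    exact (mul_eq_zero.1 h.symm).resolve_left (sub_ne_zero.2 hμ)
  by_cases hz : v 2 = 0
  · -- the point at infinity
    have hx : v 0 = 0 :=
      (pow_eq_zero_iff three_ne_zero).1 ((WeierstrassCurve.Projective.equation_of_Z_eq_zero hz).1 hWv)
    have hv1 : v 1 ≠ 0 := by
      intro h1; apply hvne
      funext i; fin_cases i
      · exact hx
      · exact h1
      · exact hz
    refine ⟨0, v 1, hv1, ?_⟩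
    rw [hv0, ← Matrix.mulVec_smul, ← hNv]
    congr 1
    funext i; fin_cases i <;> simp [hx, hz]
  · -- an affine point
    have heq : (𝐖[μ] : WeierstrassCurve K).toAffine.Equation (v 0 / v 2) (v 1 / v 2) :=
      (WeierstrassCurve.Projective.equation_of_Z_ne_zero hz).1 hWv
    have hns : (𝐖[μ] : WeierstrassCurve K).toAffine.Nonsingular (v 0 / v 2) (v 1 / v 2) :=
      (WeierstrassCurve.Affine.equation_iff_nonsingular
        (W := (𝐖[μ] : WeierstrassCurve K).toAffine)).1 heq
    refine ⟨.some _ _ hns, v 2, hz, ?_⟩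
    rw [hvs, ← Matrix.mulVec_smul, ← hNv]
    congr 1
    funext i; fin_cases i
    · simp; rw [mul_div_assoc', mul_div_cancel_left₀ _ hz]
    · simp; rw [mul_div_assoc', mul_div_cancel_left₀ _ hz]
    · simp

/-- **… uniqueness**: if `N_μ vec P = c · N_μ vec Q` then `P = Q` (distinct points of `W_μ(K)`
have non-proportional coordinate vectors and `N_μ` is invertible). [cite: Knapp1992, §II.4,
Prop. 2.14] -/
theorem point_eq_of_hessePoint_smul (h3 : (3 : K) ≠ 0) (hμ : μ ^ 3 ≠ 1) (hv0 : vec 0 = ![0, 1, 0])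
    (hvs : ∀ x y (h : (𝐖[μ] : WeierstrassCurve K).toAffine.Nonsingular x y), vec (.some x y h) = ![x, y, 1])
    {P Q : (𝐖[μ] : WeierstrassCurve K).toAffine.Point} {c : K}
    (h : (𝐍[μ] : Matrix (Fin 3) (Fin 3) K) *ᵥ vec P = c • ((𝐍[μ] : Matrix (Fin 3) (Fin 3) K) *ᵥ vec Q)) :
    P = Q := by
  have hdet := hesseN_det_ne_zero h3 hμ
  have h' : vec P = c • vec Q := by
    have := congrArg (fun w => (𝐍[μ] : Matrix (Fin 3) (Fin 3) K)⁻¹ *ᵥ w) h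
    simp only [Matrix.mulVec_mulVec, Matrix.mulVec_smul,
      Matrix.nonsing_inv_mul _ (isUnit_iff_ne_zero.2 hdet), Matrix.one_mulVec] at this
    exact this
  rcases P with _ | ⟨x, y, hP⟩ <;> rcases Q with _ | ⟨x', y', hQ⟩
  · rfl
  · rw [← WeierstrassCurve.Affine.Point.zero_def, hv0, hvs] at h'
    have e2 : (0 : K) = c * 1 := by simpa using congrFun h' 2
    have e1 : (1 : K) = c * y' := by simpa using congrFun h' 1
    rw [mul_one] at e2
    rw [← e2, zero_mul] at e1
    exact absurd e1 one_ne_zero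
  · rw [← WeierstrassCurve.Affine.Point.zero_def, hv0, hvs] at h'
    have e2 : (1 : K) = c * 0 := by simpa using congrFun h' 2
    rw [mul_zero] at e2
    exact absurd e2 one_ne_zero
  · rw [hvs, hvs] at h'
    have e2 : (1 : K) = c * 1 := by simpa using congrFun h' 2
    have hc : c = 1 := by rw [mul_one] at e2; exact e2.symm
    have e0 : x = c * x' := by simpa using congrFun h' 0
    have e1 : y = c * y' := by simpa using congrFun h' 1
    rw [hc, one_mul] at e0 e1
    subst e0; subst e1; rfl

/-- The point of `H_μ(K)` given by a matrix image: for `g` preserving `H_μ` pointwise and `P ∈ W_μ(K)`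
there is `Q` with `g (N vec P) = c · N vec Q`. [cite: ArtebaniDolgachev2009, §4 (the Hessian group
acts on each member)] -/
private theorem exists_point_image (h3 : (3 : K) ≠ 0) (hμ : μ ^ 3 ≠ 1) (hv0 : vec 0 = ![0, 1, 0])
    (hvs : ∀ x y (h : (𝐖[μ] : WeierstrassCurve K).toAffine.Nonsingular x y), vec (.some x y h) = ![x, y, 1])
    {g : Matrix (Fin 3) (Fin 3) K} (hg : ∀ p : Fin 3 → K, eval (g *ᵥ p) 𝐇[μ] = eval p 𝐇[μ])
    (hgdet : g.det ≠ 0) (P : (𝐖[μ] : WeierstrassCurve K).toAffine.Point) :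
    ∃ (Q : (𝐖[μ] : WeierstrassCurve K).toAffine.Point) (c : K),
      c ≠ 0 ∧ g *ᵥ ((𝐍[μ] : Matrix (Fin 3) (Fin 3) K) *ᵥ vec P) =
        c • ((𝐍[μ] : Matrix (Fin 3) (Fin 3) K) *ᵥ vec Q) := by
  obtain ⟨hne, hev⟩ := hessePoint_ne_zero_and_eval vec h3 hμ hv0 hvs P
  refine exists_point_of_hesse vec h3 hμ hv0 hvs ?_ (by rw [hg, hev])
  intro h0
  apply hne
  have := congrArg (fun w => g⁻¹ *ᵥ w) h0
  rwa [Matrix.mulVec_mulVec, Matrix.nonsing_inv_mul _ (isUnit_iff_ne_zero.2 hgdet),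
    Matrix.one_mulVec, Matrix.mulVec_zero] at this

/-! ## §2 `g₀` is the negation -/

/-- **`g₀ = (x, z, y)` is `p ↦ −p` for the zero `p₀`**: for `P, Q ∈ W_μ(K)`, the point
`N vec Q` of `H_μ` is (proportional to) `g₀ (N vec P)` iff `Q = −P`.  Proof: `p₀, p, g₀p` are
collinear (g20-#2 `det_p₀_p_g₀`), so `O + P + Q = O` by Cor. 10.7 with multiplicities (g20-#1),
the coincident case `g₀p ∥ p` being the `2`-torsion case `y = z` where the line is the tangent at
`p`. [cite: ArtebaniDolgachev2009, §2 (the group law with zero `p₀`), §4 (the generator `g₀`)] -/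
theorem hesse_neg_iff [DecidableEq K] (h3 : (3 : K) ≠ 0) (hμ : μ ^ 3 ≠ 1) (hv0 : vec 0 = ![0, 1, 0])
    (hvs : ∀ x y (h : (𝐖[μ] : WeierstrassCurve K).toAffine.Nonsingular x y), vec (.some x y h) = ![x, y, 1])
    (P Q : (𝐖[μ] : WeierstrassCurve K).toAffine.Point) :
    (∃ c : K, c ≠ 0 ∧ (𝐠₀ : Matrix (Fin 3) (Fin 3) K) *ᵥ ((𝐍[μ] : Matrix (Fin 3) (Fin 3) K) *ᵥ vec P) =
        c • ((𝐍[μ] : Matrix (Fin 3) (Fin 3) K) *ᵥ vec Q)) ↔ Q = -P := by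
  have hdet := hesseN_det_ne_zero h3 hμ
  have hN0 := (hesseN_mulVec μ (vec 0)).2
  -- the forward direction, for all `Q`
  have key : ∀ Q : (𝐖[μ] : WeierstrassCurve K).toAffine.Point, (∃ c : K, c ≠ 0 ∧
      (𝐠₀ : Matrix (Fin 3) (Fin 3) K) *ᵥ ((𝐍[μ] : Matrix (Fin 3) (Fin 3) K) *ᵥ vec P) =
        c • ((𝐍[μ] : Matrix (Fin 3) (Fin 3) K) *ᵥ vec Q)) → Q = -P := by
    rintro Q ⟨c, hc, hcQ⟩
    obtain ⟨hp, hpH⟩ := hessePoint_ne_zero_and_eval vec h3 hμ hv0 hvs P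
    -- `O + P + Q = 0` by the intersection-cycle lemma
    have hsum : (0 : (𝐖[μ] : WeierstrassCurve K).toAffine.Point) + P + Q = 0 := by
      refine weierstrass_add_add_eq_zero_of_intersectionCycle _ vec hv0 hvs ?_ ?_ ?_ ?_ ?_
      · -- collinear: `det[p₀; p; g₀ p] = 0`
        have h1 := det_p₀_p_g₀ ((𝐍[μ] : Matrix (Fin 3) (Fin 3) K) *ᵥ vec P)
        rw [hcQ, ← hN0, ← hv0, (det_rows_smul c _ _ _).2.1, det_rows_hesseN_mulVec] at h1
        rcases mul_eq_zero.1 h1 with h1 | h1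
        · exact absurd h1 hc
        · exact (mul_eq_zero.1 h1).resolve_left hdet
      · -- `O = P`: then `g₀ p₀ = −p₀`, so `Q = O`, and `⟨∇W(O), vec O⟩ = 0`
        rintro rfl
        have hQ : Q = 0 := by
          refine point_eq_of_hessePoint_smul vec h3 hμ hv0 hvs (c := -c⁻¹) ?_
          rw [hv0, hN0, mulVec_g₀] at hcQ
          rw [hv0, hN0]
          have e : c • ((𝐍[μ] : Matrix (Fin 3) (Fin 3) K) *ᵥ vec Q) = (-1 : K) • ![(0 : K), 1, -1] := by
            rw [← hcQ]; funext i; fin_cases i <;> simp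
          calc (𝐍[μ] : Matrix (Fin 3) (Fin 3) K) *ᵥ vec Q
              = c⁻¹ • (c • ((𝐍[μ] : Matrix (Fin 3) (Fin 3) K) *ᵥ vec Q)) := by
                rw [smul_smul, inv_mul_cancel₀ hc, one_smul]
            _ = (-c⁻¹) • ![(0 : K), 1, -1] := by rw [e, smul_smul, mul_neg_one]
        subst hQ
        exact (weierstrass_grad_dotProduct_eq_zero_iff _ vec hv0 hvs 0 0).2 (Or.inl rfl)
      · -- `O = Q`: then `p = g₀ (c p₀) = −c p₀`, so `P = O`
        rintro rfl
        have hP : P = 0 := by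
          refine point_eq_of_hessePoint_smul vec h3 hμ hv0 hvs (c := -c) ?_
          rw [hv0, hN0] at hcQ
          have e : (𝐍[μ] : Matrix (Fin 3) (Fin 3) K) *ᵥ vec P =
              (𝐠₀ : Matrix (Fin 3) (Fin 3) K) *ᵥ ((𝐠₀ : Matrix (Fin 3) (Fin 3) K) *ᵥ
                ((𝐍[μ] : Matrix (Fin 3) (Fin 3) K) *ᵥ vec P)) := by
            rw [Matrix.mulVec_mulVec, (g₀_sq_and_g₁_pow_three (K := K)).1, Matrix.one_mulVec]
          rw [e, hcQ, Matrix.mulVec_smul, mulVec_g₀, hv0, hN0]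
          funext i; fin_cases i <;> simp
        subst hP
        exact (weierstrass_grad_dotProduct_eq_zero_iff _ vec hv0 hvs 0 0).2 (Or.inl rfl)
      · -- `P = Q`: `g₀ p ∥ p`, so `y = z` (the tangent at `p` passes through `p₀`) or `p ∥ p₀`
        rintro rfl
        rcases mulVec_g₀_eq_smul hp hcQ with hyz | ⟨d, hd⟩
        · have ht := hesse_grad_dotProduct_p₀_of_eq μ hyz
          rw [← hN0, ← hv0, hesse_grad_N_dotProduct h3] at ht
          exact (mul_eq_zero.1 ht).resolve_left (sub_ne_zero.2 hμ)
        · have hP : P = 0 :=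
            point_eq_of_hessePoint_smul vec h3 hμ hv0 hvs (c := d) (by rw [hv0, hN0]; exact hd)
          subst hP
          exact (weierstrass_grad_dotProduct_eq_zero_iff _ vec hv0 hvs 0 0).2 (Or.inl rfl)
      · rintro rfl _; simp
    rw [zero_add] at hsum
    exact eq_neg_of_add_eq_zero_right hsum
  refine ⟨key Q, fun hQ => ?_⟩
  -- the converse: the image point exists and is `−P` by `key`
  obtain ⟨Q', c, hc, hcQ'⟩ := exists_point_image vec h3 hμ hv0 hvs (hesse_eval_mulVec_g₀ μ)
    (by rw [Matrix.det_fin_three]; simp) P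
  have hQ' : Q' = -P := key Q' ⟨c, hc, hcQ'⟩
  rw [hQ, ← hQ']
  exact ⟨c, hc, hcQ'⟩

/-! ## §3 The printed recipe, transported: a translation principle -/

/-- **The flexes among the base points are `3`-torsion**: if the inflection tangent at a base point
`t` meets `H_μ` only at `t` (g20-#2 `hesse_inflectionTangent_meets_only_p₀/p₁/p₃`) and `T` is the
point of `W_μ(K)` over `t`, then `3T = O` (`WeierstrassLineIntersectionCycle.weierstrass_tangent_meets_only_iff`,
transported along `N_μ`). [cite: ArtebaniDolgachev2009, §2 ("the set of inflection points is the
group of 3-torsion points of each member of the Hesse pencil")] -/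
theorem three_nsmul_eq_zero_of_inflectionTangent [DecidableEq K] (h3 : (3 : K) ≠ 0) (hμ : μ ^ 3 ≠ 1)
    (hv0 : vec 0 = ![0, 1, 0])
    (hvs : ∀ x y (h : (𝐖[μ] : WeierstrassCurve K).toAffine.Nonsingular x y), vec (.some x y h) = ![x, y, 1])
    {t : Fin 3 → K}
    (ht : ∀ q : Fin 3 → K, eval q 𝐇[μ] = 0 → (fun i => eval t (pderiv i 𝐇[μ])) ⬝ᵥ q = 0 →
      ∃ c : K, q = c • t)
    {T : (𝐖[μ] : WeierstrassCurve K).toAffine.Point} {cT : K} (hcT : cT ≠ 0)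
    (hT : (𝐍[μ] : Matrix (Fin 3) (Fin 3) K) *ᵥ vec T = cT • t) :
    3 • T = 0 := by
  refine (weierstrass_tangent_meets_only_iff _ vec hv0 hvs T).1 fun Q hQ => ?_
  obtain ⟨hq, hqH⟩ := hessePoint_ne_zero_and_eval vec h3 hμ hv0 hvs Q
  -- transport the tangency to `H_μ`: `⟨∇H(N vec T), N vec Q⟩ = 0`, then `⟨∇H(t), N vec Q⟩ = 0`
  have h1 : (fun i => eval ((𝐍[μ] : Matrix (Fin 3) (Fin 3) K) *ᵥ vec T) (pderiv i 𝐇[μ])) ⬝ᵥ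
      ((𝐍[μ] : Matrix (Fin 3) (Fin 3) K) *ᵥ vec Q) = 0 := by
    rw [hesse_grad_N_dotProduct h3, hQ, mul_zero]
  rw [hT, (hesse_eval_grad_smul μ cT t _).2, mul_eq_zero] at h1
  have h2 := h1.resolve_left (pow_ne_zero 2 hcT)
  obtain ⟨c, hc⟩ := ht _ hqH h2
  -- `N vec Q = c t = (c/cT) N vec T`
  refine point_eq_of_hessePoint_smul vec h3 hμ hv0 hvs (c := c * cT⁻¹) ?_
  rw [hc, hT, smul_smul, mul_assoc, inv_mul_cancel₀ hcT, mul_one]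

/-- **The printed recipe for `p ⊕ t`, transported — a translation principle.**  Let `g` and `σ` be
substitutions preserving the member `H_μ` pointwise, `t` a base point with the point `T ∈ W_μ(K)`
over it (`N vec T = c_T·t`), `3T = O`, and suppose, for every vector `p`: `p, t, σp` are collinear
and `p₀, σp, gp` are collinear ("`p ⊕ q` is the unique point `r` such that `p₀, r` and the third
point of intersection in `p̄q̄ ∩ E` lie on a line", with `q = t`, third point `σp`, `r = gp`),
together with the tangency/degeneracy clauses for the coincident cases (`σp ∥ p`, `σp ∥ gp`,
`σp ∥ p₀`, `gp ∥ p₀`) and `σt ∥ t`, `σ² = 1`.  Then for all `P, Q ∈ W_μ(K)`: the point `N vec Q`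
is `g(N vec P)` up to a scalar iff `Q = P + T` — `g` IS the translation by `T`.  (Both lines are
fed to Kunz Cor. 10.7 with multiplicities, g20-#1: `P + T + S = O` and `O + S + Q = O`.)
[cite: ArtebaniDolgachev2009, §2 (the group law with zero `p₀`), §4 (`g₁, g₂` induce
translations)] [cite: Kunz2005PlaneAlgebraicCurves, Ch. 10, Cor. 10.7] -/
theorem hesse_translation_principle [DecidableEq K] (h3 : (3 : K) ≠ 0) (hμ : μ ^ 3 ≠ 1)
    (hv0 : vec 0 = ![0, 1, 0])
    (hvs : ∀ x y (h : (𝐖[μ] : WeierstrassCurve K).toAffine.Nonsingular x y), vec (.some x y h) = ![x, y, 1])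
    {g σ : Matrix (Fin 3) (Fin 3) K} (hg : ∀ p : Fin 3 → K, eval (g *ᵥ p) 𝐇[μ] = eval p 𝐇[μ])
    (hgdet : g.det ≠ 0) (hσ : ∀ p : Fin 3 → K, eval (σ *ᵥ p) 𝐇[μ] = eval p 𝐇[μ])
    (hσdet : σ.det ≠ 0) (hσσ : σ * σ = 1)
    {t : Fin 3 → K} {T : (𝐖[μ] : WeierstrassCurve K).toAffine.Point} {cT : K} (hcT : cT ≠ 0)
    (hT : (𝐍[μ] : Matrix (Fin 3) (Fin 3) K) *ᵥ vec T = cT • t) (h3T : 3 • T = 0)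
    (hσt : ∃ e : K, σ *ᵥ t = e • t)
    (hdet1 : ∀ p : Fin 3 → K, (Matrix.of ![p, t, σ *ᵥ p]).det = 0)
    (hdet2 : ∀ p : Fin 3 → K, (Matrix.of ![![(0 : K), 1, -1], σ *ᵥ p, g *ᵥ p]).det = 0)
    (hcoin1 : ∀ p : Fin 3 → K, p ≠ 0 → eval p 𝐇[μ] = 0 → ∀ c : K, σ *ᵥ p = c • p →
      (fun i => eval p (pderiv i 𝐇[μ])) ⬝ᵥ t = 0 ∨ ∃ d : K, p = d • t)
    (hcoin2 : ∀ p : Fin 3 → K, p ≠ 0 → eval p 𝐇[μ] = 0 → ∀ c : K, σ *ᵥ p = c • (g *ᵥ p) →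
      (fun i => eval (σ *ᵥ p) (pderiv i 𝐇[μ])) ⬝ᵥ ![(0 : K), 1, -1] = 0 ∨
        ∃ d : K, σ *ᵥ p = d • ![(0 : K), 1, -1])
    (hS0 : ∀ (p : Fin 3 → K) (c : K), σ *ᵥ p = c • ![(0 : K), 1, -1] →
      ∃ d : K, g *ᵥ p = d • ![(0 : K), 1, -1])
    (hQ0 : ∀ (p : Fin 3 → K) (c : K), c ≠ 0 → g *ᵥ p = c • ![(0 : K), 1, -1] →
      ∃ d : K, σ *ᵥ p = d • ![(0 : K), 1, -1])
    (P Q : (𝐖[μ] : WeierstrassCurve K).toAffine.Point) :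
    (∃ c : K, c ≠ 0 ∧ g *ᵥ ((𝐍[μ] : Matrix (Fin 3) (Fin 3) K) *ᵥ vec P) =
        c • ((𝐍[μ] : Matrix (Fin 3) (Fin 3) K) *ᵥ vec Q)) ↔ Q = P + T := by
  have hdet := hesseN_det_ne_zero h3 hμ
  have hN0 := (hesseN_mulVec μ (vec 0)).2
  -- `⟨∇W(vec R), vec R⟩ = 0` (Euler), in the form the intersection-cycle lemma wants
  have euler : ∀ R : (𝐖[μ] : WeierstrassCurve K).toAffine.Point,
      (fun j => eval (vec R) (pderiv j (𝐖[μ] : WeierstrassCurve K).toProjective.polynomial)) ⬝ᵥ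
        vec R = 0 :=
    fun R => (weierstrass_grad_dotProduct_eq_zero_iff _ vec hv0 hvs R R).2 (Or.inl rfl)
  -- two Hesse points that are proportional are the same point of `W_μ(K)` (scalar on the right)
  have uniq : ∀ {R R' : (𝐖[μ] : WeierstrassCurve K).toAffine.Point} {a b : K}, a ≠ 0 →
      a • ((𝐍[μ] : Matrix (Fin 3) (Fin 3) K) *ᵥ vec R) = b • ((𝐍[μ] : Matrix (Fin 3) (Fin 3) K) *ᵥ vec R') →
      R = R' := by
    intro R R' a b ha hab
    refine point_eq_of_hessePoint_smul vec h3 hμ hv0 hvs (c := a⁻¹ * b) ?_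
    rw [← smul_smul, ← hab, smul_smul, inv_mul_cancel₀ ha, one_smul]
  -- the forward direction, for all `Q`
  have key : ∀ Q : (𝐖[μ] : WeierstrassCurve K).toAffine.Point, (∃ c : K, c ≠ 0 ∧
      g *ᵥ ((𝐍[μ] : Matrix (Fin 3) (Fin 3) K) *ᵥ vec P) =
        c • ((𝐍[μ] : Matrix (Fin 3) (Fin 3) K) *ᵥ vec Q)) → Q = P + T := by
    rintro Q ⟨c, hc, hcQ⟩
    obtain ⟨hp, hpH⟩ := hessePoint_ne_zero_and_eval vec h3 hμ hv0 hvs P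
    -- the companion point `S` over `σ p`
    obtain ⟨S, cs, hcs, hS⟩ := exists_point_image vec h3 hμ hv0 hvs hσ hσdet P
    -- Step 1: `P + T + S = O` (the line through `p` and `t`)
    have hsum1 : P + T + S = 0 := by
      refine weierstrass_add_add_eq_zero_of_intersectionCycle _ vec hv0 hvs ?_ ?_ ?_ ?_ ?_
      · have h1 := hdet1 ((𝐍[μ] : Matrix (Fin 3) (Fin 3) K) *ᵥ vec P)
        have h2 : (Matrix.of ![(𝐍[μ] : Matrix (Fin 3) (Fin 3) K) *ᵥ vec P,
            (𝐍[μ] : Matrix (Fin 3) (Fin 3) K) *ᵥ vec T, σ *ᵥ ((𝐍[μ] : Matrix (Fin 3) (Fin 3) K) *ᵥ vec P)]).det = 0 := by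
          rw [hT, (det_rows_smul cT _ _ _).1, h1, mul_zero]
        rw [hS, (det_rows_smul cs _ _ _).2.1, det_rows_hesseN_mulVec] at h2
        rcases mul_eq_zero.1 h2 with h2 | h2
        · exact absurd h2 hcs
        · exact (mul_eq_zero.1 h2).resolve_left hdet
      · -- `P = T`: then `σ p ∥ σ t ∥ t ∥ p`, so `S = P`
        rintro rfl
        obtain ⟨e, he⟩ := hσt
        have hSP : S = P := by
          refine uniq (R := S) (R' := P) (a := cs) (b := e) hcs ?_
          rw [← hS, hT, Matrix.mulVec_smul, he, smul_smul, smul_smul, mul_comm]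
        rw [hSP]; exact euler P
      · -- `P = S`: `σ p ∥ p`, so the tangent at `p` passes through `t`, or `p ∥ t`
        rintro rfl
        rcases hcoin1 _ hp hpH cs hS with h | ⟨d, hd⟩
        · have h' : (fun i => eval ((𝐍[μ] : Matrix (Fin 3) (Fin 3) K) *ᵥ vec P) (pderiv i 𝐇[μ])) ⬝ᵥ
              ((𝐍[μ] : Matrix (Fin 3) (Fin 3) K) *ᵥ vec T) = 0 := by
            rw [hT, dotProduct_smul, h, smul_zero]
          rw [hesse_grad_N_dotProduct h3, mul_eq_zero] at h'
          exact h'.resolve_left (sub_ne_zero.2 hμ)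
        · have hd0 : d ≠ 0 := by rintro rfl; exact hp (by rw [hd, zero_smul])
          have hPT : P = T := uniq (R := P) (R' := T) (a := cT) (b := d) hcT
            (by rw [hd, hT, smul_smul, smul_smul, mul_comm])
          subst hPT; exact euler P
      · -- `T = S`: `σ p ∥ t`, so `p = σ σ p ∥ σ t ∥ t`, `P = T`
        rintro rfl
        obtain ⟨e, he⟩ := hσt
        have hPT : P = T := by
          refine uniq (a := (1 : K)) (b := cs * e) one_ne_zero ?_
          have e1 : (𝐍[μ] : Matrix (Fin 3) (Fin 3) K) *ᵥ vec P =
              σ *ᵥ (σ *ᵥ ((𝐍[μ] : Matrix (Fin 3) (Fin 3) K) *ᵥ vec P)) := by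
            rw [Matrix.mulVec_mulVec, hσσ, Matrix.one_mulVec]
          have e2 : t = cT⁻¹ • ((𝐍[μ] : Matrix (Fin 3) (Fin 3) K) *ᵥ vec T) := by
            rw [hT, smul_smul, inv_mul_cancel₀ hcT, one_smul]
          rw [one_smul, e1, hS, Matrix.mulVec_smul, hT, Matrix.mulVec_smul, he, e2]
          simp only [smul_smul]
          congr 1
          field_simp
        subst hPT; exact euler P
      · rintro rfl _; exact h3T
    -- Step 2: `O + S + Q = O` (the line through `p₀` and `σ p`)
    have hsum2 : (0 : (𝐖[μ] : WeierstrassCurve K).toAffine.Point) + S + Q = 0 := by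
      refine weierstrass_add_add_eq_zero_of_intersectionCycle _ vec hv0 hvs ?_ ?_ ?_ ?_ ?_
      · have h1 := hdet2 ((𝐍[μ] : Matrix (Fin 3) (Fin 3) K) *ᵥ vec P)
        rw [hS, hcQ, ← hN0, ← hv0, (det_rows_smul cs _ _ _).1, (det_rows_smul c _ _ _).2.1,
          det_rows_hesseN_mulVec] at h1
        rcases mul_eq_zero.1 h1 with h1 | h1
        · exact absurd h1 hcs
        rcases mul_eq_zero.1 h1 with h1 | h1
        · exact absurd h1 hc
        · exact (mul_eq_zero.1 h1).resolve_left hdet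
      · -- `O = S`: `σ p ∥ p₀` forces `g p ∥ p₀`, `Q = O`
        rintro h0S
        obtain ⟨d, hd⟩ := hS0 _ (cs * 1) (by rw [hS, ← h0S, hv0, hN0, mul_one])
        have hd0 : d ≠ 0 := by
          rintro rfl
          rw [zero_smul] at hd
          rw [hd] at hcQ
          exact (hessePoint_ne_zero_and_eval vec h3 hμ hv0 hvs Q).1
            ((smul_eq_zero.1 hcQ.symm).resolve_left hc)
        have hQ : Q = 0 := uniq (a := c) (b := d) hc (by rw [← hcQ, hd, hv0, hN0])
        rw [hQ]; exact euler 0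
      · -- `O = Q`: `g p ∥ p₀` forces `σ p ∥ p₀`, `S = O`
        rintro h0Q
        obtain ⟨d, hd⟩ := hQ0 _ c hc (by rw [hcQ, ← h0Q, hv0, hN0])
        have hd0 : d ≠ 0 := by
          rintro rfl
          rw [zero_smul] at hd
          rw [hd] at hS
          exact (hessePoint_ne_zero_and_eval vec h3 hμ hv0 hvs S).1
            ((smul_eq_zero.1 hS.symm).resolve_left hcs)
        have hS' : S = 0 := uniq (a := cs) (b := d) hcs (by rw [← hS, hd, hv0, hN0])
        rw [hS']; exact euler 0
      · -- `S = Q`: `σ p ∥ g p`, so the line through `p₀` is tangent at `σ p`, or `σ p ∥ p₀`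
        intro hSQ
        subst hSQ
        have hpar : σ *ᵥ ((𝐍[μ] : Matrix (Fin 3) (Fin 3) K) *ᵥ vec P) =
            (cs * c⁻¹) • (g *ᵥ ((𝐍[μ] : Matrix (Fin 3) (Fin 3) K) *ᵥ vec P)) := by
          rw [hS, hcQ, smul_smul, mul_assoc, inv_mul_cancel₀ hc, mul_one]
        rcases hcoin2 _ hp hpH _ hpar with h | ⟨d, hd⟩
        · rw [hS, (hesse_eval_grad_smul μ cs _ _).2, ← hN0, ← hv0, hesse_grad_N_dotProduct h3,
            mul_eq_zero, mul_eq_zero] at h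
          rcases h with h | h | h
          · exact absurd h (pow_ne_zero 2 hcs)
          · exact absurd h (sub_ne_zero.2 hμ)
          · exact h
        · have hS' : S = 0 := uniq (a := cs) (b := d) hcs (by rw [← hS, hd, hv0, hN0])
          subst hS'; exact euler 0
      · intro _ _; simp
    rw [zero_add] at hsum2
    rw [eq_neg_of_add_eq_zero_right hsum2, eq_neg_of_add_eq_zero_right hsum1, neg_neg]
  refine ⟨key Q, fun hQ => ?_⟩
  obtain ⟨Q', c, hc, hcQ'⟩ := exists_point_image vec h3 hμ hv0 hvs hg hgdet P
  rw [hQ, ← key Q' ⟨c, hc, hcQ'⟩]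
  exact ⟨c, hc, hcQ'⟩

/-! ## §4 `g₂` is the translation by `p₁`, `t₃ = g₁⁻¹` the translation by `p₃` -/

/-- Where `g₂`, `σ₁`, `t₃`, `σ₃` send the base points needed below (`ω³ = 1`):
`g₂ p₁ = ω·p₂`, `g₂ p₂ = ω·p₀`, `σ₁ p₂ = −ω·p₀`; `σ₃ p₆ = −p₀`, `t₃ p₆ = p₀`, `t₃ p₃ = −p₆`, and
`t₃³ = 1` on vectors. [cite: ArtebaniDolgachev2009, §4 (the permutations of the base points induced
by `g₁, g₂`)] -/
private theorem basePoint_moves {ω : K} (h3 : ω ^ 3 = 1) (p : Fin 3 → K) :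
    (𝐠₂[ω] : Matrix (Fin 3) (Fin 3) K) *ᵥ ![0, 1, -ω] = ω • ![(0 : K), 1, -ω ^ 2] ∧
      (𝐠₂[ω] : Matrix (Fin 3) (Fin 3) K) *ᵥ ![0, 1, -ω ^ 2] = ω • ![(0 : K), 1, -1] ∧
      (𝛔₁[ω] : Matrix (Fin 3) (Fin 3) K) *ᵥ ![0, 1, -ω ^ 2] = (-ω) • ![(0 : K), 1, -1] ∧
      (𝛔₃ : Matrix (Fin 3) (Fin 3) K) *ᵥ ![1, -1, 0] = (-1 : K) • ![(0 : K), 1, -1] ∧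
      (𝐭₃ : Matrix (Fin 3) (Fin 3) K) *ᵥ ![1, -1, 0] = ![(0 : K), 1, -1] ∧
      (𝐭₃ : Matrix (Fin 3) (Fin 3) K) *ᵥ ![1, 0, -1] = (-1 : K) • ![(1 : K), -1, 0] ∧
      (𝐭₃ : Matrix (Fin 3) (Fin 3) K) *ᵥ ((𝐭₃ : Matrix (Fin 3) (Fin 3) K) *ᵥ
        ((𝐭₃ : Matrix (Fin 3) (Fin 3) K) *ᵥ p)) = p := by
  have h4 : ω ^ 4 = ω := by rw [show ω ^ 4 = ω ^ 3 * ω by ring, h3, one_mul]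
  refine ⟨?_, ?_, ?_, ?_, ?_, ?_, ?_⟩
  · rw [mulVec_g₂]; funext i; fin_cases i <;> simp; ring
  · rw [mulVec_g₂]; funext i; fin_cases i <;> simp; linear_combination h4
  · rw [mulVec_σ₁]; funext i; fin_cases i <;> simp; linear_combination h4
  · rw [mulVec_σ₃]; funext i; fin_cases i <;> simp
  · rw [mulVec_t₃]; funext i; fin_cases i <;> simp
  · rw [mulVec_t₃]; funext i; fin_cases i <;> simp
  · rw [mulVec_t₃, mulVec_t₃, mulVec_t₃]; funext i; fin_cases i <;> simp

/-- **The base points `p₁` and `p₃` are points of `W_μ(K)`**: there are `T₁, T₃ ∈ W_μ(K)` with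
`N vec T₁ ∥ p₁ = (0, 1, −ω)` and `N vec T₃ ∥ p₃ = (1, 0, −1)` (`ω³ = 1`).
[cite: ArtebaniDolgachev2009, §2 ("they are the inflection points of any smooth curve in the
pencil")] -/
theorem exists_point_p₁_p₃ (h3 : (3 : K) ≠ 0) (hμ : μ ^ 3 ≠ 1) {ω : K} (h3ω : ω ^ 3 = 1)
    (hv0 : vec 0 = ![0, 1, 0])
    (hvs : ∀ x y (h : (𝐖[μ] : WeierstrassCurve K).toAffine.Nonsingular x y), vec (.some x y h) = ![x, y, 1]) :
    (∃ (T₁ : (𝐖[μ] : WeierstrassCurve K).toAffine.Point) (c₁ : K),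
        c₁ ≠ 0 ∧ (𝐍[μ] : Matrix (Fin 3) (Fin 3) K) *ᵥ vec T₁ = c₁ • ![(0 : K), 1, -ω]) ∧
      ∃ (T₃ : (𝐖[μ] : WeierstrassCurve K).toAffine.Point) (c₃ : K),
        c₃ ≠ 0 ∧ (𝐍[μ] : Matrix (Fin 3) (Fin 3) K) *ᵥ vec T₃ = c₃ • ![(1 : K), 0, -1] := by
  constructor
  · have h := (hesse_grad_basePoint₀ μ h3ω (1 : K)).1
    rw [one_smul] at h
    obtain ⟨T, c, hc, hcT⟩ := exists_point_of_hesse vec h3 hμ hv0 hvs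
      (p := ![(0 : K), 1, -ω]) (fun h0 => by simpa using congrFun h0 1) h
    exact ⟨T, c⁻¹, inv_ne_zero hc, by rw [hcT, smul_smul, inv_mul_cancel₀ hc, one_smul]⟩
  · have h := (hesse_grad_basePoint₁ μ (w := (1 : K)) (one_pow 3) (1 : K)).1
    rw [one_smul] at h
    obtain ⟨T, c, hc, hcT⟩ := exists_point_of_hesse vec h3 hμ hv0 hvs
      (p := ![(1 : K), 0, -1]) (fun h0 => by simpa using congrFun h0 0) h
    exact ⟨T, c⁻¹, inv_ne_zero hc, by rw [hcT, smul_smul, inv_mul_cancel₀ hc, one_smul]⟩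

/-- **`p₁` is a `3`-torsion point** ("the set of inflection points is the group of 3-torsion
points"): `3T₁ = O` for the point over `p₁` — its inflection tangent meets `H_μ` only at `p₁`
(g20-#2 `hesse_inflectionTangent_meets_only_p₁`). [cite: ArtebaniDolgachev2009, §2] -/
theorem three_nsmul_T₁ [DecidableEq K] (h3 : (3 : K) ≠ 0) (hμ : μ ^ 3 ≠ 1) {ω : K}
    (h3ω : ω ^ 3 = 1) (hv0 : vec 0 = ![0, 1, 0])
    (hvs : ∀ x y (h : (𝐖[μ] : WeierstrassCurve K).toAffine.Nonsingular x y), vec (.some x y h) = ![x, y, 1])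
    {T₁ : (𝐖[μ] : WeierstrassCurve K).toAffine.Point} {c₁ : K} (hc₁ : c₁ ≠ 0)
    (hT₁ : (𝐍[μ] : Matrix (Fin 3) (Fin 3) K) *ᵥ vec T₁ = c₁ • ![(0 : K), 1, -ω]) : 3 • T₁ = 0 :=
  three_nsmul_eq_zero_of_inflectionTangent vec h3 hμ hv0 hvs
    (fun _ hq ht => hesse_inflectionTangent_meets_only_p₁ h3 hμ h3ω hq ht) hc₁ hT₁

/-- **`p₃` is a `3`-torsion point**: `3T₃ = O` for the point over `p₃`
(g20-#2 `hesse_inflectionTangent_meets_only_p₃`). [cite: ArtebaniDolgachev2009, §2] -/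
theorem three_nsmul_T₃ [DecidableEq K] (h3 : (3 : K) ≠ 0) (hμ : μ ^ 3 ≠ 1)
    (hv0 : vec 0 = ![0, 1, 0])
    (hvs : ∀ x y (h : (𝐖[μ] : WeierstrassCurve K).toAffine.Nonsingular x y), vec (.some x y h) = ![x, y, 1])
    {T₃ : (𝐖[μ] : WeierstrassCurve K).toAffine.Point} {c₃ : K} (hc₃ : c₃ ≠ 0)
    (hT₃ : (𝐍[μ] : Matrix (Fin 3) (Fin 3) K) *ᵥ vec T₃ = c₃ • ![(1 : K), 0, -1]) : 3 • T₃ = 0 :=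
  three_nsmul_eq_zero_of_inflectionTangent vec h3 hμ hv0 hvs
    (fun _ hq ht => hesse_inflectionTangent_meets_only_p₃ h3 hμ hq ht) hc₃ hT₃

/-- **"`g₂` [induces the translation] by the point `p₁`"**: for the point `T₁ ∈ W_μ(K)` over the
base point `p₁ = (0, 1, −ε)` and all `P, Q ∈ W_μ(K)`, the point `N vec Q` of `H_μ` is
`g₂ (N vec P) = (x, εy, ε²z)` up to a scalar if and only if `Q = P + T₁` (`3 ≠ 0`, `μ³ ≠ 1`,
`ε = ω`, `ω² + ω + 1 = 0`).  By the translation principle with companion `σ₁` (g20-#2: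
`det[p; p₁; σ₁p] = 0`, `det[p₀; σ₁p; g₂p] = 0`). [cite: ArtebaniDolgachev2009, §4 ("`g₂` that by
the point `p₁`")] -/
theorem hesse_translation_g₂_iff [DecidableEq K] (h3 : (3 : K) ≠ 0) (hμ : μ ^ 3 ≠ 1) {ω : K}
    (hω : ω ^ 2 + ω + 1 = 0) (hv0 : vec 0 = ![0, 1, 0])
    (hvs : ∀ x y (h : (𝐖[μ] : WeierstrassCurve K).toAffine.Nonsingular x y), vec (.some x y h) = ![x, y, 1])
    {T₁ : (𝐖[μ] : WeierstrassCurve K).toAffine.Point} {c₁ : K} (hc₁ : c₁ ≠ 0)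
    (hT₁ : (𝐍[μ] : Matrix (Fin 3) (Fin 3) K) *ᵥ vec T₁ = c₁ • ![(0 : K), 1, -ω])
    (P Q : (𝐖[μ] : WeierstrassCurve K).toAffine.Point) :
    (∃ c : K, c ≠ 0 ∧ (𝐠₂[ω] : Matrix (Fin 3) (Fin 3) K) *ᵥ ((𝐍[μ] : Matrix (Fin 3) (Fin 3) K) *ᵥ vec P) =
        c • ((𝐍[μ] : Matrix (Fin 3) (Fin 3) K) *ᵥ vec Q)) ↔ Q = P + T₁ := by
  have h3ω : ω ^ 3 = 1 := by linear_combination (ω - 1) * hω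
  have hω0 : ω ≠ 0 := fun h0 => by rw [h0] at h3ω; norm_num at h3ω
  obtain ⟨m₁, m₂, m₃, -, -, -, -⟩ := basePoint_moves h3ω (0 : Fin 3 → K)
  obtain ⟨b₀, b₁, b₂⟩ := g₂_σ₁_mulVec_basePoints (K := K) h3ω
  have hg3 := g₂_pow_three_mulVec (K := K) h3ω
  have hσσ : (𝛔₁[ω] : Matrix (Fin 3) (Fin 3) K) * 𝛔₁[ω] = 1 := (t₃_eq_g₁_sq_and_σ_sq h3ω).2.1
  refine hesse_translation_principle vec h3 hμ hv0 hvs (hesse_eval_mulVec_g₂ μ h3ω)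
    ?_ (hesse_eval_mulVec_σ₁ μ h3ω) ?_ hσσ hc₁ hT₁ (three_nsmul_T₁ vec h3 hμ h3ω hv0 hvs hc₁ hT₁)
    ⟨-1, b₂⟩ (det_p_p₁_σ₁ h3ω) (det_p₀_σ₁_g₂ ω) ?_ ?_ ?_ ?_ P Q
  · -- `det g₂ = ω³ ≠ 0`
    rw [Matrix.det_fin_three]; simp [hω0]
  · -- `det σ₁ = −ω³ ≠ 0`
    rw [Matrix.det_fin_three]; simp [hω0]
  · -- coincidence `σ₁ p ∥ p`
    intro p hp _ c h
    rcases mulVec_σ₁_eq_smul h3ω hp h with h' | h'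
    · exact Or.inl (hesse_grad_dotProduct_p₁_of_eq μ h3ω h')
    · exact Or.inr h'
  · -- coincidence `σ₁ p ∥ g₂ p`
    intro p hp _ c h
    rcases mulVec_σ₁_eq_smul_mulVec_g₂ h3ω hp h with h' | ⟨d, hd⟩
    · exact Or.inl (hesse_grad_σ₁_dotProduct_p₀_of_eq μ ω h')
    · refine Or.inr ⟨d * -ω, ?_⟩
      rw [hd, Matrix.mulVec_smul, m₃, smul_smul]
  · -- `σ₁ p ∥ p₀ ⇒ g₂ p ∥ p₀`
    intro p c h
    have e : p = (𝛔₁[ω] : Matrix (Fin 3) (Fin 3) K) *ᵥ ((𝛔₁[ω] : Matrix (Fin 3) (Fin 3) K) *ᵥ p) := by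
      rw [Matrix.mulVec_mulVec, hσσ, Matrix.one_mulVec]
    refine ⟨-c, ?_⟩
    rw [e, h, Matrix.mulVec_smul, Matrix.mulVec_smul, mulVec_σ₁, mulVec_g₂]
    funext i; fin_cases i
    · simp
    · simp; linear_combination c * h3ω
    · simp; linear_combination c * h3ω
  · -- `g₂ p ∥ p₀ ⇒ σ₁ p ∥ p₀`
    intro p c _ h
    have e : p = (𝐠₂[ω] : Matrix (Fin 3) (Fin 3) K) *ᵥ ((𝐠₂[ω] : Matrix (Fin 3) (Fin 3) K) *ᵥ
        ((𝐠₂[ω] : Matrix (Fin 3) (Fin 3) K) *ᵥ p)) := (hg3 p).symm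
    refine ⟨-c, ?_⟩
    rw [e, h, Matrix.mulVec_smul, Matrix.mulVec_smul, Matrix.mulVec_smul, mulVec_g₂, mulVec_g₂,
      mulVec_σ₁]
    funext i; fin_cases i
    · simp
    · simp; linear_combination (c * (ω ^ 3 + 1)) * h3ω
    · simp; linear_combination c * h3ω

/-- **"`g₁` induces the translation by the 3-torsion point `p₃`"**, for the point map
`t₃ = g₁⁻¹ = (z, x, y)`: for the point `T₃ ∈ W_μ(K)` over `p₃ = (1, 0, −1)` and all `P, Q`, the
point `N vec Q` is `t₃ (N vec P)` up to a scalar iff `Q = P + T₃` (`3 ≠ 0`, `μ³ ≠ 1`; no root of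
unity needed).  By the translation principle with companion `σ₃` (g20-#2: `det[p; p₃; σ₃p] = 0`,
`det[p₀; σ₃p; t₃p] = 0`). [cite: ArtebaniDolgachev2009, §4 ("`g₁` induces the translation by the
3-torsion point `p₃`")] -/
theorem hesse_translation_t₃_iff [DecidableEq K] (h3 : (3 : K) ≠ 0) (hμ : μ ^ 3 ≠ 1)
    (hv0 : vec 0 = ![0, 1, 0])
    (hvs : ∀ x y (h : (𝐖[μ] : WeierstrassCurve K).toAffine.Nonsingular x y), vec (.some x y h) = ![x, y, 1])
    {T₃ : (𝐖[μ] : WeierstrassCurve K).toAffine.Point} {c₃ : K} (hc₃ : c₃ ≠ 0)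
    (hT₃ : (𝐍[μ] : Matrix (Fin 3) (Fin 3) K) *ᵥ vec T₃ = c₃ • ![(1 : K), 0, -1])
    (P Q : (𝐖[μ] : WeierstrassCurve K).toAffine.Point) :
    (∃ c : K, c ≠ 0 ∧ (𝐭₃ : Matrix (Fin 3) (Fin 3) K) *ᵥ ((𝐍[μ] : Matrix (Fin 3) (Fin 3) K) *ᵥ vec P) =
        c • ((𝐍[μ] : Matrix (Fin 3) (Fin 3) K) *ᵥ vec Q)) ↔ Q = P + T₃ := by
  obtain ⟨-, -, -, m₄, m₅, m₆, -⟩ := basePoint_moves (one_pow 3 : (1 : K) ^ 3 = 1) (0 : Fin 3 → K)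
  have hg3 := fun p : Fin 3 → K => (basePoint_moves (one_pow 3 : (1 : K) ^ 3 = 1) p).2.2.2.2.2.2
  obtain ⟨c₀, c₁', c₂, -⟩ := t₃_σ₃_mulVec_basePoints (K := K)
  have hσσ : (𝛔₃ : Matrix (Fin 3) (Fin 3) K) * 𝛔₃ = 1 := (t₃_eq_g₁_sq_and_σ_sq (one_pow 3 : (1 : K) ^ 3 = 1)).2.2
  refine hesse_translation_principle vec h3 hμ hv0 hvs (hesse_eval_mulVec_t₃ μ)
    ?_ (hesse_eval_mulVec_σ₃ μ) ?_ hσσ hc₃ hT₃ (three_nsmul_T₃ vec h3 hμ hv0 hvs hc₃ hT₃)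
    ⟨-1, c₂⟩ det_p_p₃_σ₃ det_p₀_σ₃_t₃ ?_ ?_ ?_ ?_ P Q
  · rw [Matrix.det_fin_three]; simp
  · rw [Matrix.det_fin_three]; simp
  · intro p hp _ c h
    rcases mulVec_σ₃_eq_smul hp h with h' | h'
    · exact Or.inl (hesse_grad_dotProduct_p₃_of_eq μ h')
    · exact Or.inr h'
  · intro p hp _ c h
    rcases mulVec_σ₃_eq_smul_mulVec_t₃ hp h with h' | ⟨d, hd⟩
    · exact Or.inl (hesse_grad_σ₃_dotProduct_p₀_of_eq μ h')
    · refine Or.inr ⟨d * -1, ?_⟩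
      rw [hd, Matrix.mulVec_smul, m₄, smul_smul]
  · intro p c h
    have e : p = (𝛔₃ : Matrix (Fin 3) (Fin 3) K) *ᵥ ((𝛔₃ : Matrix (Fin 3) (Fin 3) K) *ᵥ p) := by
      rw [Matrix.mulVec_mulVec, hσσ, Matrix.one_mulVec]
    refine ⟨-c, ?_⟩
    rw [e, h, Matrix.mulVec_smul, Matrix.mulVec_smul, mulVec_σ₃, mulVec_t₃]
    funext i; fin_cases i <;> simp
  · intro p c _ h
    have e : p = (𝐭₃ : Matrix (Fin 3) (Fin 3) K) *ᵥ ((𝐭₃ : Matrix (Fin 3) (Fin 3) K) *ᵥ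
        ((𝐭₃ : Matrix (Fin 3) (Fin 3) K) *ᵥ p)) := (hg3 p).symm
    refine ⟨-c, ?_⟩
    rw [e, h, Matrix.mulVec_smul, Matrix.mulVec_smul, Matrix.mulVec_smul, mulVec_t₃, mulVec_t₃,
      mulVec_σ₃]
    funext i; fin_cases i <;> simp

/-- **The printed `g₁(x, y, z) = (y, z, x)` on points is the translation by `−p₃ = p₆`**
(`g₁ = t₃⁻¹`): `N vec Q ∥ g₁ (N vec P)` iff `Q = P − T₃` — the point/coordinate convention
recorded in `HessePencilBasePoints.affine_σ₁` (`σ₁ = +(0, 2)`). [cite: ArtebaniDolgachev2009, §4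
("`g₁` induces the translation by the 3-torsion point `p₃`")] -/
theorem hesse_translation_g₁_iff [DecidableEq K] (h3 : (3 : K) ≠ 0) (hμ : μ ^ 3 ≠ 1)
    (hv0 : vec 0 = ![0, 1, 0])
    (hvs : ∀ x y (h : (𝐖[μ] : WeierstrassCurve K).toAffine.Nonsingular x y), vec (.some x y h) = ![x, y, 1])
    {T₃ : (𝐖[μ] : WeierstrassCurve K).toAffine.Point} {c₃ : K} (hc₃ : c₃ ≠ 0)
    (hT₃ : (𝐍[μ] : Matrix (Fin 3) (Fin 3) K) *ᵥ vec T₃ = c₃ • ![(1 : K), 0, -1])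
    (P Q : (𝐖[μ] : WeierstrassCurve K).toAffine.Point) :
    (∃ c : K, c ≠ 0 ∧ (𝐠₁ : Matrix (Fin 3) (Fin 3) K) *ᵥ ((𝐍[μ] : Matrix (Fin 3) (Fin 3) K) *ᵥ vec P) =
        c • ((𝐍[μ] : Matrix (Fin 3) (Fin 3) K) *ᵥ vec Q)) ↔ Q = P - T₃ := by
  -- `t₃ g₁ = 1`
  have ht : (𝐭₃ : Matrix (Fin 3) (Fin 3) K) * 𝐠₁ = 1 := by
    rw [(t₃_eq_g₁_sq_and_σ_sq (one_pow 3 : (1 : K) ^ 3 = 1)).1]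
    exact (g₀_sq_and_g₁_pow_three (K := K)).2
  have hg : (𝐠₁ : Matrix (Fin 3) (Fin 3) K) * 𝐭₃ = 1 := by
    rw [(t₃_eq_g₁_sq_and_σ_sq (one_pow 3 : (1 : K) ^ 3 = 1)).1, ← Matrix.mul_assoc]
    exact (g₀_sq_and_g₁_pow_three (K := K)).2
  rw [eq_sub_iff_add_eq, eq_comm, ← hesse_translation_t₃_iff vec h3 hμ hv0 hvs hc₃ hT₃ Q P]
  constructor
  · rintro ⟨c, hc, h⟩
    refine ⟨c⁻¹, inv_ne_zero hc, ?_⟩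
    have := congrArg (fun w => (𝐭₃ : Matrix (Fin 3) (Fin 3) K) *ᵥ w) h
    rw [Matrix.mulVec_mulVec, ht, Matrix.one_mulVec, Matrix.mulVec_smul] at this
    rw [this, smul_smul, inv_mul_cancel₀ hc, one_smul]
  · rintro ⟨c, hc, h⟩
    refine ⟨c⁻¹, inv_ne_zero hc, ?_⟩
    have := congrArg (fun w => (𝐠₁ : Matrix (Fin 3) (Fin 3) K) *ᵥ w) h
    rw [Matrix.mulVec_mulVec, hg, Matrix.one_mulVec, Matrix.mulVec_smul] at this
    rw [this, smul_smul, inv_mul_cancel₀ hc, one_smul]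

/-! ## §5 A–D's table (matrix2): the nine base points are `a·T₁ + b·T₃` -/

/-- One step of the table: from the point over `x` to the point over `g₂ x`, which is `+T₁`.
[cite: ArtebaniDolgachev2009, §2 (the identification (matrix2))] -/
private theorem table_step_g₂ [DecidableEq K] (h3 : (3 : K) ≠ 0) (hμ : μ ^ 3 ≠ 1) {ω : K}
    (hω : ω ^ 2 + ω + 1 = 0) (hv0 : vec 0 = ![0, 1, 0])
    (hvs : ∀ x y (h : (𝐖[μ] : WeierstrassCurve K).toAffine.Nonsingular x y), vec (.some x y h) = ![x, y, 1])
    {T₁ : (𝐖[μ] : WeierstrassCurve K).toAffine.Point} {c₁ : K} (hc₁ : c₁ ≠ 0)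
    (hT₁ : (𝐍[μ] : Matrix (Fin 3) (Fin 3) K) *ᵥ vec T₁ = c₁ • ![(0 : K), 1, -ω])
    {X : (𝐖[μ] : WeierstrassCurve K).toAffine.Point} {x : Fin 3 → K}
    (hX : ∃ c : K, c ≠ 0 ∧ (𝐍[μ] : Matrix (Fin 3) (Fin 3) K) *ᵥ vec X = c • x) :
    ∃ c : K, c ≠ 0 ∧ (𝐍[μ] : Matrix (Fin 3) (Fin 3) K) *ᵥ vec (X + T₁) =
      c • ((𝐠₂[ω] : Matrix (Fin 3) (Fin 3) K) *ᵥ x) := by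
  obtain ⟨cX, hcX, hx⟩ := hX
  obtain ⟨c, hc, h⟩ := (hesse_translation_g₂_iff vec h3 hμ hω hv0 hvs hc₁ hT₁ X (X + T₁)).2 rfl
  refine ⟨c⁻¹ * cX, mul_ne_zero (inv_ne_zero hc) hcX, ?_⟩
  rw [← smul_smul, ← Matrix.mulVec_smul, ← hx, h, smul_smul, inv_mul_cancel₀ hc, one_smul]

/-- One step of the table: from the point over `x` to the point over `t₃ x`, which is `+T₃`.
[cite: ArtebaniDolgachev2009, §2 (the identification (matrix2))] -/
private theorem table_step_t₃ [DecidableEq K] (h3 : (3 : K) ≠ 0) (hμ : μ ^ 3 ≠ 1)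
    (hv0 : vec 0 = ![0, 1, 0])
    (hvs : ∀ x y (h : (𝐖[μ] : WeierstrassCurve K).toAffine.Nonsingular x y), vec (.some x y h) = ![x, y, 1])
    {T₃ : (𝐖[μ] : WeierstrassCurve K).toAffine.Point} {c₃ : K} (hc₃ : c₃ ≠ 0)
    (hT₃ : (𝐍[μ] : Matrix (Fin 3) (Fin 3) K) *ᵥ vec T₃ = c₃ • ![(1 : K), 0, -1])
    {X : (𝐖[μ] : WeierstrassCurve K).toAffine.Point} {x : Fin 3 → K}
    (hX : ∃ c : K, c ≠ 0 ∧ (𝐍[μ] : Matrix (Fin 3) (Fin 3) K) *ᵥ vec X = c • x) :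
    ∃ c : K, c ≠ 0 ∧ (𝐍[μ] : Matrix (Fin 3) (Fin 3) K) *ᵥ vec (X + T₃) =
      c • ((𝐭₃ : Matrix (Fin 3) (Fin 3) K) *ᵥ x) := by
  obtain ⟨cX, hcX, hx⟩ := hX
  obtain ⟨c, hc, h⟩ := (hesse_translation_t₃_iff vec h3 hμ hv0 hvs hc₃ hT₃ X (X + T₃)).2 rfl
  refine ⟨c⁻¹ * cX, mul_ne_zero (inv_ne_zero hc) hcX, ?_⟩
  rw [← smul_smul, ← Matrix.mulVec_smul, ← hx, h, smul_smul, inv_mul_cancel₀ hc, one_smul]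

/-- Rescaling the target of a table entry. [folklore] -/
private theorem table_rescale {X : (𝐖[μ] : WeierstrassCurve K).toAffine.Point} {x y : Fin 3 → K}
    {e : K} (he : e ≠ 0) (hxy : x = e • y)
    (hX : ∃ c : K, c ≠ 0 ∧ (𝐍[μ] : Matrix (Fin 3) (Fin 3) K) *ᵥ vec X = c • x) :
    ∃ c : K, c ≠ 0 ∧ (𝐍[μ] : Matrix (Fin 3) (Fin 3) K) *ᵥ vec X = c • y := by
  obtain ⟨c, hc, h⟩ := hX
  exact ⟨c * e, mul_ne_zero hc he, by rw [h, hxy, smul_smul]⟩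

/-- **A–D's identification (matrix2) of the nine base points with `(ℤ/3ℤ)²`, as a theorem about the
group law with zero `p₀`**: with `T₁, T₃ ∈ W_μ(K)` the points over `p₁ = (0, 1, −ε)` ("`↦ (1, 0)`")
and `p₃ = (1, 0, −1)` ("`↦ (0, 1)`"), the point `a·T₁ + b·T₃` lies over `p_{a+3b}` for all nine
`(a, b)`:  `O ↦ p₀`, `T₁ ↦ p₁`, `2T₁ ↦ p₂`, `T₃ ↦ p₃`, `T₁ + T₃ ↦ p₄ = (1, 0, −ε²)`,
`2T₁ + T₃ ↦ p₅ = (1, 0, −ε)`, `2T₃ ↦ p₆ = (1, −1, 0)`, `T₁ + 2T₃ ↦ p₇ = (1, −ε, 0)`,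
`2T₁ + 2T₃ ↦ p₈ = (1, −ε², 0)` (`3 ≠ 0`, `μ³ ≠ 1`, `ε = ω`, `ω² + ω + 1 = 0`; obtained by walking
the table with `g₂ = +T₁` and `t₃ = +T₃`). [cite: ArtebaniDolgachev2009, §2 (the isomorphism
`α : E_λ[3]_{p₀} → (ℤ/3ℤ)²`, `p₁ ↦ (1,0)`, `p₃ ↦ (0,1)`, and the table (matrix2))] -/
theorem hesse_basePoints_eq_torsion [DecidableEq K] (h3 : (3 : K) ≠ 0) (hμ : μ ^ 3 ≠ 1) {ω : K}
    (hω : ω ^ 2 + ω + 1 = 0) (hv0 : vec 0 = ![0, 1, 0])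
    (hvs : ∀ x y (h : (𝐖[μ] : WeierstrassCurve K).toAffine.Nonsingular x y), vec (.some x y h) = ![x, y, 1])
    {T₁ T₃ : (𝐖[μ] : WeierstrassCurve K).toAffine.Point} {c₁ c₃ : K} (hc₁ : c₁ ≠ 0)
    (hT₁ : (𝐍[μ] : Matrix (Fin 3) (Fin 3) K) *ᵥ vec T₁ = c₁ • ![(0 : K), 1, -ω]) (hc₃ : c₃ ≠ 0)
    (hT₃ : (𝐍[μ] : Matrix (Fin 3) (Fin 3) K) *ᵥ vec T₃ = c₃ • ![(1 : K), 0, -1]) :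
    (𝐍[μ] : Matrix (Fin 3) (Fin 3) K) *ᵥ vec 0 = ![0, 1, -1] ∧
      (∃ c : K, c ≠ 0 ∧ (𝐍[μ] : Matrix (Fin 3) (Fin 3) K) *ᵥ vec (2 • T₁) = c • ![(0 : K), 1, -ω ^ 2]) ∧
      (∃ c : K, c ≠ 0 ∧ (𝐍[μ] : Matrix (Fin 3) (Fin 3) K) *ᵥ vec (T₁ + T₃) = c • ![(1 : K), 0, -ω ^ 2]) ∧
      (∃ c : K, c ≠ 0 ∧ (𝐍[μ] : Matrix (Fin 3) (Fin 3) K) *ᵥ vec (2 • T₁ + T₃) = c • ![(1 : K), 0, -ω]) ∧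
      (∃ c : K, c ≠ 0 ∧ (𝐍[μ] : Matrix (Fin 3) (Fin 3) K) *ᵥ vec (2 • T₃) = c • ![(1 : K), -1, 0]) ∧
      (∃ c : K, c ≠ 0 ∧ (𝐍[μ] : Matrix (Fin 3) (Fin 3) K) *ᵥ vec (T₁ + 2 • T₃) = c • ![(1 : K), -ω, 0]) ∧
      (∃ c : K, c ≠ 0 ∧ (𝐍[μ] : Matrix (Fin 3) (Fin 3) K) *ᵥ vec (2 • T₁ + 2 • T₃) = c • ![(1 : K), -ω ^ 2, 0]) := by
  have h3ω : ω ^ 3 = 1 := by linear_combination (ω - 1) * hω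
  have h4 : ω ^ 4 = ω := by rw [show ω ^ 4 = ω ^ 3 * ω by ring, h3ω, one_mul]
  have hω0 : ω ≠ 0 := fun h0 => by rw [h0] at h3ω; norm_num at h3ω
  have hN0 := (hesseN_mulVec μ (vec 0)).2
  rw [hv0]
  have hT₁' : ∃ c : K, c ≠ 0 ∧ (𝐍[μ] : Matrix (Fin 3) (Fin 3) K) *ᵥ vec T₁ = c • ![(0 : K), 1, -ω] :=
    ⟨c₁, hc₁, hT₁⟩
  have hT₃' : ∃ c : K, c ≠ 0 ∧ (𝐍[μ] : Matrix (Fin 3) (Fin 3) K) *ᵥ vec T₃ = c • ![(1 : K), 0, -1] :=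
    ⟨c₃, hc₃, hT₃⟩
  -- `2T₁` over `g₂ p₁ = ω p₂`
  have h2T₁ : ∃ c : K, c ≠ 0 ∧ (𝐍[μ] : Matrix (Fin 3) (Fin 3) K) *ᵥ vec (2 • T₁) = c • ![(0 : K), 1, -ω ^ 2] := by
    rw [two_nsmul]
    exact table_rescale vec hω0 (basePoint_moves h3ω 0).1 (table_step_g₂ vec h3 hμ hω hv0 hvs hc₁ hT₁ hT₁')
  -- `T₁ + T₃ = T₃ + T₁` over `g₂ p₃ = p₄`
  have hT₁T₃ : ∃ c : K, c ≠ 0 ∧ (𝐍[μ] : Matrix (Fin 3) (Fin 3) K) *ᵥ vec (T₁ + T₃) = c • ![(1 : K), 0, -ω ^ 2] := by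
    rw [add_comm]
    refine table_rescale vec one_ne_zero ?_ (table_step_g₂ vec h3 hμ hω hv0 hvs hc₁ hT₁ hT₃')
    rw [mulVec_g₂, one_smul]; funext i; fin_cases i <;> simp
  -- `2T₁ + T₃` over `g₂ p₄ = p₅`
  have h2T₁T₃ : ∃ c : K, c ≠ 0 ∧ (𝐍[μ] : Matrix (Fin 3) (Fin 3) K) *ᵥ vec (2 • T₁ + T₃) = c • ![(1 : K), 0, -ω] := by
    rw [two_nsmul, show T₁ + T₁ + T₃ = (T₁ + T₃) + T₁ by abel]
    refine table_rescale vec one_ne_zero ?_ (table_step_g₂ vec h3 hμ hω hv0 hvs hc₁ hT₁ hT₁T₃)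
    rw [mulVec_g₂, one_smul]; funext i; fin_cases i <;> simp; linear_combination h4
  -- `2T₃` over `t₃ p₃ = −p₆`
  have h2T₃ : ∃ c : K, c ≠ 0 ∧ (𝐍[μ] : Matrix (Fin 3) (Fin 3) K) *ᵥ vec (2 • T₃) = c • ![(1 : K), -1, 0] := by
    rw [two_nsmul]
    exact table_rescale vec (neg_ne_zero.2 one_ne_zero) (basePoint_moves h3ω 0).2.2.2.2.2.1 (table_step_t₃ vec h3 hμ hv0 hvs hc₃ hT₃ hT₃')
  -- `T₁ + 2T₃ = 2T₃ + T₁` over `g₂ p₆ = p₇`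
  have hT₁2T₃ : ∃ c : K, c ≠ 0 ∧ (𝐍[μ] : Matrix (Fin 3) (Fin 3) K) *ᵥ vec (T₁ + 2 • T₃) = c • ![(1 : K), -ω, 0] := by
    rw [add_comm]
    refine table_rescale vec one_ne_zero ?_ (table_step_g₂ vec h3 hμ hω hv0 hvs hc₁ hT₁ h2T₃)
    rw [mulVec_g₂, one_smul]; funext i; fin_cases i <;> simp
  -- `2T₁ + 2T₃` over `g₂ p₇ = p₈`
  have h2T₁2T₃ : ∃ c : K, c ≠ 0 ∧ (𝐍[μ] : Matrix (Fin 3) (Fin 3) K) *ᵥ vec (2 • T₁ + 2 • T₃) = c • ![(1 : K), -ω ^ 2, 0] := by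
    rw [show 2 • T₁ + 2 • T₃ = (T₁ + 2 • T₃) + T₁ by rw [two_nsmul]; abel]
    refine table_rescale vec one_ne_zero ?_ (table_step_g₂ vec h3 hμ hω hv0 hvs hc₁ hT₁ hT₁2T₃)
    rw [mulVec_g₂, one_smul]; funext i; fin_cases i <;> simp; ring
  exact ⟨hN0, h2T₁, hT₁T₃, h2T₁T₃, h2T₃, hT₁2T₃, h2T₁2T₃⟩

/-- **"the set of inflection points is the group of 3-torsion points of each member"** — the
inclusion that holds over any field: the nine base points are the `3`-torsion points
`a·T₁ + b·T₃` (`hesse_basePoints_eq_torsion`, `3T₁ = 3T₃ = O`); over an algebraically closed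
field they are ALL of `W_μ(K)[3]` by the count `#W_μ(K)[3] = 9`
(`WeierstrassNineFlexes.card_torsionBy_three`, not repeated here). [cite: ArtebaniDolgachev2009,
§2] -/
theorem three_nsmul_basePoints [DecidableEq K] (h3 : (3 : K) ≠ 0) (hμ : μ ^ 3 ≠ 1) {ω : K}
    (h3ω : ω ^ 3 = 1) (hv0 : vec 0 = ![0, 1, 0])
    (hvs : ∀ x y (h : (𝐖[μ] : WeierstrassCurve K).toAffine.Nonsingular x y), vec (.some x y h) = ![x, y, 1])
    {T₁ T₃ : (𝐖[μ] : WeierstrassCurve K).toAffine.Point} {c₁ c₃ : K} (hc₁ : c₁ ≠ 0)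
    (hT₁ : (𝐍[μ] : Matrix (Fin 3) (Fin 3) K) *ᵥ vec T₁ = c₁ • ![(0 : K), 1, -ω]) (hc₃ : c₃ ≠ 0)
    (hT₃ : (𝐍[μ] : Matrix (Fin 3) (Fin 3) K) *ᵥ vec T₃ = c₃ • ![(1 : K), 0, -1]) (a b : ℕ) :
    3 • (a • T₁ + b • T₃) = 0 := by
  rw [smul_add, smul_comm 3 a, smul_comm 3 b, three_nsmul_T₁ vec h3 hμ h3ω hv0 hvs hc₁ hT₁,
    three_nsmul_T₃ vec h3 hμ hv0 hvs hc₃ hT₃, smul_zero, smul_zero, add_zero]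

end GroupLaw

end Literature.AlgebraicGeometry.PlaneCurves
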